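import Summits.BirchSwinnertonDyer.BirchSwinnertonDyer.Theorems.EdixhovenFibreFiveSevenStarredOptimalManinUnitFiveSevenHcorTwoAdicRounds
import Summits.BirchSwinnertonDyer.BirchSwinnertonDyer.Theorems.EdixhovenFibreFiveSevenStarredOptimalManinUnitFiveSevenHcorNotFourDvd
import Literature.NumberTheory.Automorphic.UnboundedDenominatorsInvariantHomTransferStep
import HarnessLib

set_option linter.dupNamespace false

/-!
# K★ crux `StarredOptimalManinUnitFiveSeven`, line `cdt_thm1`: the stub `stub_hcor_invariant` (all levels)

The `2`-adic case of the registered stub `CdtThm1.stub_hcor_invariant` (the `SL₂(ℤ)`-invariant form of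
[CalegariDimitrovTang2025, Corollary 4.5.3]).  For `4 ∣ N` and a finite commutative target of exponent `2^a`,
an invariant `θ : Γ(N) → Q` kills `Γ(2·4^{a+1}·N)` (`two_adic_kill`: transfer steps at the odd primes `p` with
`p² ∣ N` as in `HcorBlocks`, then the `2`-adic rounds `HcorTwoAdic.map_eq_one_of_mem_Gamma_pow_mul` on the level
`2N = m·2^{e+1}`, `m` odd squarefree).  Corestriction to the `ℓ`-primary parts of a general finite commutative
target (odd `ℓ`: `HcorBlocks` + `block_certificate_primePow_odd`; `ℓ = 2`: `two_adic_kill`) gives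
`map_eq_one_of_four_dvd` and `two_adic_case` (the hypothesis of `HcorNotFourDvd.stub_hcor_invariant_of_two_adic`);
the stub itself was landed first as `HcorTwoPow.stub_hcor_invariant_all` by a different route, so this file
is an independent second proof of its `2`-adic case.  K★ / the Manin-constant statement / BSD are NOT proved by this file alone.
-/

open scoped MatrixGroups commutatorElement

universe u

namespace Summit.BirchSwinnertonDyer.BirchSwinnertonDyer.Theorems

namespace HcorTwoAdic

open CongruenceSubgroup Matrix.SpecialLinearGroup ModularGroup
open Literature.NumberTheory.Automorphic.UnboundedDenominators

/-- `Γ(L) ≤ Γ(M)` for `M ∣ L`. [folklore] -/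
private theorem Gamma_le_of_dvd {M L : ℕ} (h : M ∣ L) : Gamma L ≤ Gamma M :=
  Literature.NumberTheory.Automorphic.Wohlfahrt.Gamma_le_Gamma_of_dvd h

/-- The transfer step with the level as a variable. [cite: CalegariDimitrovTang2025, Corollary 4.5.3] -/
private theorem transfer_step' {Q : Type*} [CommGroup Q] {N M p e M₀ : ℕ} [NeZero M] (hN : N = M * p)
    (hp : p.Prime) (hpM : p ∣ M) (hcop : e.Coprime p) (hQ : ∀ q : Q, q ^ e = 1)
    (hM : ∀ ψ : Gamma M →* Q,
      (∀ (g x : SL(2, ℤ)) (hx : x ∈ Gamma M) (hgx : g * x * g⁻¹ ∈ Gamma M),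
        ψ ⟨g * x * g⁻¹, hgx⟩ = ψ ⟨x, hx⟩) →
      ∀ (x : SL(2, ℤ)) (hx : x ∈ Gamma M), x ∈ Gamma M₀ → ψ ⟨x, hx⟩ = 1)
    (θ : Gamma N →* Q)
    (hθ : ∀ (g x : SL(2, ℤ)) (hx : x ∈ Gamma N) (hgx : g * x * g⁻¹ ∈ Gamma N),
      θ ⟨g * x * g⁻¹, hgx⟩ = θ ⟨x, hx⟩) :
    ∀ (x : SL(2, ℤ)) (hx : x ∈ Gamma N), x ∈ Gamma M₀ → θ ⟨x, hx⟩ = 1 := by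
  subst hN
  exact map_eq_one_of_transfer_step hp hpM hcop hQ hM θ hθ

/-- **The `2`-adic kill.**  For `Q` finite commutative of exponent `2^a`, every `N ≠ 0` with `4 ∣ N` and every
`SL₂(ℤ)`-invariant `θ : Γ(N) → Q`, `θ` is trivial on `Γ(2·4^{a+1}·N)`. [cite: CalegariDimitrovTang2025,
Corollary 4.5.3] [cite: Beyl1986, Theorem] -/
theorem two_adic_kill (a : ℕ) (Q : Type u) [CommGroup Q] [Finite Q] (hQ : ∀ q : Q, q ^ 2 ^ a = 1) :
    ∀ {N : ℕ}, N ≠ 0 → 4 ∣ N → ∀ (θ : Gamma N →* Q),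
      (∀ (g x : SL(2, ℤ)) (hx : x ∈ Gamma N) (hgx : g * x * g⁻¹ ∈ Gamma N),
        θ ⟨g * x * g⁻¹, hgx⟩ = θ ⟨x, hx⟩) →
      ∀ (x : SL(2, ℤ)) (hx : x ∈ Gamma N), x ∈ Gamma (2 * 4 ^ (a + 1) * N) → θ ⟨x, hx⟩ = 1 := by
  intro N
  induction N using Nat.strong_induction_on with
  | _ N ih =>
  intro hN0 h4 θ hθ x hx hxM
  by_cases hA : ∃ p : ℕ, p.Prime ∧ p ≠ 2 ∧ p * p ∣ N
  · obtain ⟨p, hp, hp2, c, hc⟩ := hA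
    have hc0 : c ≠ 0 := by rintro rfl; exact hN0 (by rw [hc, mul_zero])
    haveI : NeZero (p * c) := ⟨Nat.mul_ne_zero hp.ne_zero hc0⟩
    have hNM : N = p * c * p := by rw [hc]; ring
    have hMlt : p * c < N := by
      rw [hNM]
      exact lt_mul_of_one_lt_right (Nat.pos_of_ne_zero (Nat.mul_ne_zero hp.ne_zero hc0)) hp.one_lt
    have h2p : Nat.Coprime 2 p := (Nat.coprime_primes Nat.prime_two hp).mpr (Ne.symm hp2)
    have h4M : 4 ∣ p * c := by
      have h4p : Nat.Coprime 4 p := by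
        have := Nat.Coprime.pow_left 2 h2p; norm_num at this; exact this
      rw [hNM] at h4
      exact h4p.dvd_of_dvd_mul_right h4
    have hcop : (2 ^ a).Coprime p := Nat.Coprime.pow_left a h2p
    have hM := fun (ψ : Gamma (p * c) →* Q) hψ ↦
      ih (p * c) hMlt (NeZero.ne _) h4M ψ hψ
    have h1 := transfer_step' hNM hp (dvd_mul_right p c) hcop hQ hM θ hθ x hx
    apply h1
    exact Gamma_le_of_dvd (by rw [hNM]; exact ⟨p, by ring⟩) hxM
  · -- terminal case: `N = 2^e m` with `m` odd squarefree, `e ≥ 2`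
    simp only [not_exists, not_and] at hA
    set e : ℕ := N.factorization 2 with he_def
    set m : ℕ := ordCompl[2] N with hm_def
    have hNem : 2 ^ e * m = N := Nat.ordProj_mul_ordCompl_eq_self N 2
    have hm2 : m.Coprime 2 := (Nat.coprime_ordCompl Nat.prime_two hN0).symm
    have hm0 : m ≠ 0 := by rintro h0; rw [h0, mul_zero] at hNem; exact hN0 hNem.symm
    have hm : Squarefree m := by
      rw [Nat.squarefree_iff_prime_squarefree]
      intro p hp hpp
      by_cases hp2 : p = 2
      · subst hp2
        have : 2 ∣ m := dvd_trans ⟨2, rfl⟩ hpp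
        exact absurd (Nat.Coprime.coprime_dvd_left this hm2) (by norm_num)
      · exact hA p hp hp2 (hpp.trans ⟨2 ^ e, by rw [← hNem]; ring⟩)
    have he2 : 2 ≤ e := by
      rw [he_def, ← Nat.Prime.pow_dvd_iff_le_factorization Nat.prime_two hN0]; norm_num; exact h4
    -- restrict to `Γ(2N) = Γ(m·2^{e+1})`
    have hL : m * 2 ^ (e + 1) = 2 * N := by rw [← hNem]; ring
    have hle : Gamma (m * 2 ^ (e + 1)) ≤ Gamma N := Gamma_le_of_dvd ⟨2, by rw [hL]; ring⟩
    let θ₀ : Gamma (m * 2 ^ (e + 1)) →* Q := θ.comp (Subgroup.inclusion hle)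
    have hθ₀ : ∀ (g y : SL(2, ℤ)) (hy : y ∈ Gamma (m * 2 ^ (e + 1)))
        (hgy : g * y * g⁻¹ ∈ Gamma (m * 2 ^ (e + 1))), θ₀ ⟨g * y * g⁻¹, hgy⟩ = θ₀ ⟨y, hy⟩ :=
      fun g y hy hgy ↦ hθ g y (hle hy) (hle hgy)
    have hxL4 : x ∈ Gamma (4 ^ (a + 1) * (m * 2 ^ (e + 1))) := by
      rw [hL, show 4 ^ (a + 1) * (2 * N) = 2 * 4 ^ (a + 1) * N by ring]; exact hxM
    have hxL : x ∈ Gamma (m * 2 ^ (e + 1)) := Gamma_le_of_dvd (dvd_mul_left _ _) hxL4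
    have h1 := map_eq_one_of_mem_Gamma_pow_mul (by omega) hm hm2 hQ θ₀ hθ₀ x hxL hxL4
    exact h1

/-- **For `4 ∣ N`, every `SL₂(ℤ)`-invariant `θ : Γ(N) → Q` to a finite commutative group kills
`Γ(12 N · 2·4^{v+1})`, `v = v₂(|Q|)`.**  Corestriction to the `ℓ`-primary parts: odd `ℓ` by the odd block
certificates (`HcorBlocks`, `block_certificate_primePow_odd`), `ℓ = 2` by `two_adic_kill`.
[cite: CalegariDimitrovTang2025, Corollary 4.5.3] [cite: Beyl1986, Theorem] -/
theorem map_eq_one_of_four_dvd {N : ℕ} (hN0 : N ≠ 0) (h4 : 4 ∣ N) (Q : Type u) [CommGroup Q] [Finite Q]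
    (θ : Gamma N →* Q)
    (hθ : ∀ (g x : SL(2, ℤ)) (hx : x ∈ Gamma N) (hgx : g * x * g⁻¹ ∈ Gamma N),
      θ ⟨g * x * g⁻¹, hgx⟩ = θ ⟨x, hx⟩) :
    ∀ (x : SL(2, ℤ)) (hx : x ∈ Gamma N),
      x ∈ Gamma (12 * N * (2 * 4 ^ ((Nat.card Q).factorization 2 + 1))) → θ ⟨x, hx⟩ = 1 := by
  intro x hx hxM
  set n : ℕ := Nat.card Q with hn
  have hn0 : n ≠ 0 := Nat.card_pos.ne'
  have hx12 : x ∈ Gamma (12 * N) := Gamma_le_of_dvd (dvd_mul_right _ _) hxM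
  have hx2 : x ∈ Gamma (2 * 4 ^ (n.factorization 2 + 1) * N) :=
    Gamma_le_of_dvd ⟨12, by ring⟩ hxM
  by_contra hne
  have hord : orderOf (θ ⟨x, hx⟩) ≠ 1 := fun h1 ↦ hne (orderOf_eq_one_iff.mp h1)
  obtain ⟨ℓ, hℓ, hℓq⟩ := Nat.exists_prime_and_dvd hord
  have hℓn : ℓ ∣ n := hℓq.trans (orderOf_dvd_of_pow_eq_one (hn ▸ pow_card_eq_one'))
  -- corestriction to the `ℓ`-power torsion
  set m : ℕ := ordCompl[ℓ] n with hm_def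
  have hnm : ordProj[ℓ] n * m = n := Nat.ordProj_mul_ordCompl_eq_self n ℓ
  have hpow : ∀ (y : Gamma N), ((powMonoidHom m).comp θ) y = θ y ^ m := fun y ↦ rfl
  have he : ∀ y : Gamma N, ((powMonoidHom m).comp θ) y ^ (ℓ ^ n.factorization ℓ) = 1 := by
    intro y
    rw [hpow, ← pow_mul, mul_comm, hnm, hn]
    exact pow_card_eq_one'
  set T : Subgroup Q := (powMonoidHom (ℓ ^ n.factorization ℓ) : Q →* Q).ker with hT
  set θT : Gamma N →* T := ((powMonoidHom m).comp θ).codRestrict T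
    (fun y ↦ by rw [hT, MonoidHom.mem_ker, powMonoidHom_apply]; exact he y) with hθT
  have hθTval : ∀ y : Gamma N, ((θT y : T) : Q) = θ y ^ m := fun y ↦ rfl
  have hQT : ∀ q : T, q ^ (ℓ ^ n.factorization ℓ) = 1 := by
    intro q
    apply Subtype.ext
    have hq : (q : Q) ∈ (powMonoidHom (ℓ ^ n.factorization ℓ) : Q →* Q).ker := q.2
    rw [MonoidHom.mem_ker, powMonoidHom_apply] at hq
    rw [Subgroup.coe_pow, Subgroup.coe_one]
    exact hq
  have hθTinv : ∀ (g y : SL(2, ℤ)) (hy : y ∈ Gamma N) (hgy : g * y * g⁻¹ ∈ Gamma N),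
      θT ⟨g * y * g⁻¹, hgy⟩ = θT ⟨y, hy⟩ := by
    intro g y hy hgy
    apply Subtype.ext
    rw [hθTval, hθTval, hθ g y hy hgy]
  have key : θ ⟨x, hx⟩ ^ m = 1 := by
    by_cases hℓ2 : ℓ = 2
    · subst hℓ2
      have h1 := two_adic_kill (n.factorization 2) T hQT hN0 h4 θT hθTinv x hx hx2
      have h2 := congrArg Subtype.val h1
      rw [hθTval, Subgroup.coe_one] at h2
      exact h2
    · have hcertT : ∀ (e m' : ℕ), 3 ≤ e → ℓ ^ e ∣ N → m' ≠ 0 → m'.Coprime ℓ →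
          ∀ (ψ : Gamma (m' * ℓ ^ e) →* T),
          (∀ (g x : SL(2, ℤ)) (hx : x ∈ Gamma (m' * ℓ ^ e)) (hgx : g * x * g⁻¹ ∈ Gamma (m' * ℓ ^ e)),
            ψ ⟨g * x * g⁻¹, hgx⟩ = ψ ⟨x, hx⟩) →
          ∀ (y : SL(2, ℤ)) (hy : y ∈ Gamma (m' * ℓ ^ e)),
            y ∈ ⁅Gamma m', Gamma m'⁆ ⊔ ψ.ker.map (Gamma (m' * ℓ ^ e)).subtype → ψ ⟨y, hy⟩ = 1 := by
        intro e m' _ _ _ hm'ℓ ψ hψ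
        haveI : Fact ℓ.Prime := ⟨hℓ⟩
        exact block_certificate_primePow_odd hℓ2 hm'ℓ T hQT ψ hψ
      have h1 := HcorBlocks.cor453_invariant_form_of_block_certificates_exponent hℓ T hQT hN0
        (fun h ↦ absurd h hℓ2) hcertT θT hθTinv x hx hx12
      have h2 := congrArg Subtype.val h1
      rw [hθTval, Subgroup.coe_one] at h2
      exact h2
  have h1 : ℓ ∣ ordCompl[ℓ] n := hℓq.trans (orderOf_dvd_of_pow_eq_one key)
  exact hℓ.one_lt.ne' (Nat.Coprime.eq_one_of_dvd (Nat.coprime_ordCompl hℓ hn0) h1)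

/-- **The `2`-adic case of the stub**: for `N ≠ 0` with `4 ∣ N`, every `SL₂(ℤ)`-invariant homomorphism
`Γ(N) → Q` to a finite commutative group kills some `Γ(M)`, `M ≠ 0`. [cite: CalegariDimitrovTang2025, Corollary
4.5.3] -/
theorem two_adic_case : ∀ (N : ℕ), N ≠ 0 → 4 ∣ N → ∀ (Q : Type) [CommGroup Q] [Finite Q] (θ : Gamma N →* Q),
    (∀ (g x : SL(2, ℤ)) (hx : x ∈ Gamma N) (hgx : g * x * g⁻¹ ∈ Gamma N),
      θ ⟨g * x * g⁻¹, hgx⟩ = θ ⟨x, hx⟩) →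
    ∃ M : ℕ, M ≠ 0 ∧ ∀ (x : SL(2, ℤ)) (hx : x ∈ Gamma N), x ∈ Gamma M → θ ⟨x, hx⟩ = 1 := by
  intro N hN0 h4 Q _ _ θ hθ
  refine ⟨12 * N * (2 * 4 ^ ((Nat.card Q).factorization 2 + 1)), ?_, map_eq_one_of_four_dvd hN0 h4 Q θ hθ⟩
  exact Nat.mul_ne_zero (Nat.mul_ne_zero (by norm_num) hN0)
    (Nat.mul_ne_zero two_ne_zero (pow_ne_zero _ (by norm_num)))

-- The registered stub itself is `HcorTwoPow.stub_hcor_invariant_all` (landed first by the sibling seat); the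
-- theorems above give an independent proof of its `2`-adic case via the Schur multiplier of `SL₂(ℤ/2^e)`.

end HcorTwoAdic

end Summit.BirchSwinnertonDyer.BirchSwinnertonDyer.Theorems
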